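import Summits.BirchSwinnertonDyer.BirchSwinnertonDyer.Theorems.SignedLowerHalvesSmallImageLowerHalfBothSignsRttCharRoadE1LocalDescent
import Summits.BirchSwinnertonDyer.BirchSwinnertonDyer.Theorems.SignedLowerHalvesSmallImageLowerHalfBothSignsRttCharRoadE1LocalSquareTrace
import HarnessLib

/-!
# Route `SignedLowerHalves`, crux L `SmallImageLowerHalfBothSigns` (stmt-BirchSwinnertonDyer-23599), line `rtt_w3` v11 — brick D3-W AT `p`,
# FINAL LOCAL FORM for the cores route (memo `Lines/rtt_w3-MEMO-D3c-w3g17.md` §5–§7): the abstract descent (p765485) composed with the concrete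
# square (p765739 `Λ' = localSubgroupOfEmb (Γ_{k_n} ⊓ galRange K) ι`, p766226 `hA'tr`).

Width seat `bsd-line-slh-p3-w3` g17 under LEAD `cruxlead-stmt-BirchSwinnertonDyer-23599` (cell `bsd-ssimc`; `--supports stmt-BirchSwinnertonDyer-23599 --as helper`).
THEOREMS ONLY (no definition, no named fact, no instance, no `sorry`). BSD / crux L / INJ are NOT proved here.

WHAT. `k ⊆ K` quadratic number fields (`hK2`), `p` odd, `κ` a `ℤ_p`-extension of `k` and `κ_K = κ.restrictOfFinrankEqTwo` its restriction; the local
base-change square `(ι, ι₂, ι', hcompat)` of `Rank1Residual/Additive/LocalSubgroupTransport` for a `k`-completion model `E` and a `K`-completion model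
`E' ⊇ E` with `ι₂` `E`-linear (`hι₂`), the fixing hypothesis for `galRange K` (`hfixU`), `galRange K` of index `2` (`hU`), and `c ∈ Λ_n = Gal(K̄_E/k_n E)`
restricting OUTSIDE `galRange K` (a Frobenius-type element at the inert prime). In the cores route the `k`-side class at layer `n` is `ψ = cor ξ`; on
`Λ'_n = Λ_n ∩ res⁻¹(galRange K) = Gal(K̄_E/K_n E')` its local crossed homomorphism is the Kummer cocycle of the QUADRATIC TRACE `R = Q + cQ` of the
transport `Q = transportPoints Q_K` of the `K`-side Kummer witness (`res ∘ cor = 1 + c_*` at cocycle level; `c_*` of a Kummer cocycle is the Kummer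
cocycle of `cQ`). THIS FILE: such a `ψ` satisfies Kobayashi's Kummer condition at `ι` from `A = E^ε(k_n·E)`:
* ★★★ `mem_localKummerOverOfEmb_signed_of_kummer_trace_witness` — if `ψ ∈ Z¹(Γ_{k_n}, E[p^∞])` is killed by `p^a` and on `Λ'_n` its local crossed
  homomorphism is `τ ↦ τR − R`, `R = transportPoints Q_K + c • transportPoints Q_K` with `p^{k'} Q_K ∈ E^ε(K_n·E')`, then
  `[ψ] ∈ localKummerOverOfEmb W p Γ_{k_n} ι (E^ε(k_n·E))` — p765485 with `A' := A` (`A` is fixed by `Λ_n ∋ c`), `Q' := R`, and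
  `p^{k'}R = P' + cP' ∈ A` for `P' = transportPoints (p^{k'}Q_K)` by `hA'tr` (p766226).
* `nsmul_add_smul_transportPoints` — `p^{k'} • (Q + cQ) = transportPoints (p^{k'}Q_K) + c • transportPoints (p^{k'}Q_K)`.

References: [Kobayashi2003] Def. 1.1; [BDKim2009] §2 p. 185; [SerreGaloisCohomology1997] I §2.4–§2.6, II §1.1; [MilneADT2006] I Prop. 3.8.
-/

set_option autoImplicit false
set_option linter.dupNamespace false -- D-0017: single-problem summit, the namespace repeats the problem name by design
noncomputable section

open scoped Classical

universe u

namespace Summit.BirchSwinnertonDyer.BirchSwinnertonDyer.Theorems.SmallImageCharSignedSelmer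

open Literature.NumberTheory.EllipticCurves Literature.NumberTheory.GaloisRepresentations Field
  Summit.BirchSwinnertonDyer.Rank1Residual.Additive.LocalTransport

section AtP

variable {k : Type u} [Field k] [NumberField k] {p : ℕ} [hp : Fact p.Prime] (hp2 : p ≠ 2) (κ : ZpExtension k p)
  (K : Type u) [Field K] [NumberField K] [Algebra k K] (hK2 : Module.finrank k K = 2)
  {E : Type u} [Field E] [Algebra k E] {E' : Type u} [Field E'] [Algebra K E'] [Algebra E E'] [Algebra k E'] [IsScalarTower k K E']
  (ι : AlgebraicClosure k →ₐ[k] AlgebraicClosure E) (ι₂ : AlgebraicClosure E ≃+* AlgebraicClosure E')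
  (ι' : AlgebraicClosure K →ₐ[K] AlgebraicClosure E')
  (hcompat : ∀ z : AlgebraicClosure k, ι' (closureEmb (K := k) K z) = ι₂ (ι z))
  (hι₂ : ∀ a : E, ι₂ (algebraMap E (AlgebraicClosure E) a) = algebraMap E' (AlgebraicClosure E') (algebraMap E E' a))
  (hfixU : ∀ h : absoluteGaloisGroup E, resGalOfEmb ι h ∈ galRange (K := k) K → ∀ y : E',
    (show AlgebraicClosure E ≃ₐ[E] AlgebraicClosure E from h) (ι₂.symm (algebraMap E' (AlgebraicClosure E') y)) =
      ι₂.symm (algebraMap E' (AlgebraicClosure E') y))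
  (hU : (galRange (K := k) K).index = 2) (W : WeierstrassCurve k)

omit [NumberField k] [NumberField K] hp [Algebra E E'] in
/-- `p^{k'} • (Q + cQ) = transportPoints (p^{k'} Q_K) + c • transportPoints (p^{k'} Q_K)` for `Q = transportPoints Q_K`. [folklore] -/
theorem nsmul_add_smul_transportPoints (c : absoluteGaloisGroup E) (Q_K : localPoints (W.baseChange K) E') (m : ℕ) :
    m • (transportPoints K ι ι₂ ι' hcompat W Q_K + c • transportPoints K ι ι₂ ι' hcompat W Q_K) =
      transportPoints K ι ι₂ ι' hcompat W (m • Q_K) + c • transportPoints K ι ι₂ ι' hcompat W (m • Q_K) := by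
  rw [smul_add, map_nsmul]
  congr 1
  exact (map_nsmul (DistribSMul.toAddMonoidHom (localPoints W E) c) m (transportPoints K ι ι₂ ι' hcompat W Q_K)).symm

include hι₂ hfixU hU in
/-- ★★★ **D3-W at `p`, final local form (cores route).** Let `ψ ∈ Z¹(Γ_{k_n}, E[p^∞])` (`Γ_{k_n} = κ.layerSubgroup n`) be killed by `p^a`, `p` odd,
and suppose that on `Λ'_n = localSubgroupOfEmb (Γ_{k_n} ⊓ galRange K) ι` its local crossed homomorphism `τ ↦ ι_*ψ(τ|)` is the Kummer cocycle
`τ ↦ τR − R` of the quadratic trace `R = transportPoints Q_K + c • transportPoints Q_K` of a `K`-side Kummer witness `Q_K ∈ E_K(Ē')` with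
`p^{k'}Q_K ∈ E^ε(K_n·E')` (Kobayashi's signed points of `W_K` over the `κ_K`-layers at `ι'`), where `c ∈ Λ_n` restricts outside `galRange K`
(`galRange K` of index `2`). Then `[ψ]` satisfies Kobayashi's Kummer condition at `ι` from `A = E^ε(k_n·E)`:
`[ψ] ∈ localKummerOverOfEmb W p Γ_{k_n} ι A`. Proof: p765485 with `Λ' = Λ'_n` (`c² ∈ Λ'`, `c⁻¹Λ'c ⊆ Λ'`, `Λ = Λ' ∪ cΛ'`: p765739), `A' := A`
(`A ≤ E(k_n·E)` is fixed by `Λ_n ∋ c`), `Q' := R`, and `p^{k'}R = P' + cP' ∈ A`, `P' = transportPoints (p^{k'}Q_K)`, by `hA'tr` (p766226).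
[cite: Kobayashi2003, Def. 1.1] [cite: BDKim2009, §2 p. 185] [cite: SerreGaloisCohomology1997, I §2.6 (b)] -/
theorem mem_localKummerOverOfEmb_signed_of_kummer_trace_witness (ε : ℤˣ) (n : ℕ) {c : absoluteGaloisGroup E}
    (hc : c ∈ localSubgroupOfEmb (κ.layerSubgroup n) ι) (hcU : resGalOfEmb ι c ∉ galRange (K := k) K)
    (ψ : contOneCocycles (discreteTopRep (κ.layerSubgroup n) (W.geomPrimaryTorsion p))) {a : ℕ}
    (ha : ∀ x : κ.layerSubgroup n, p ^ a • ψ.1 x = 0) (Q_K : localPoints (W.baseChange K) E') (k' : ℕ)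
    (hQA : p ^ k' • Q_K ∈ Kobayashi2003.signedLocalPointsOfEmb (κ.restrictOfFinrankEqTwo hp2 K hK2) ι' (W.baseChange K) ε n)
    (hψ : ∀ (τ : absoluteGaloisGroup E) (hτ : τ ∈ localSubgroupOfEmb (κ.layerSubgroup n ⊓ galRange (K := k) K) ι),
      pointsMapOfEmb W ι ((ψ.1 (resGalSubgroupOfEmb (κ.layerSubgroup n) ι
          ⟨τ, localSubgroupOfEmb_inf_le (κ.layerSubgroup n) (galRange (K := k) K) ι hτ⟩) : W.geomPrimaryTorsion p) : W.geomPoints) =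
        τ • (transportPoints K ι ι₂ ι' hcompat W Q_K + c • transportPoints K ι ι₂ ι' hcompat W Q_K) -
          (transportPoints K ι ι₂ ι' hcompat W Q_K + c • transportPoints K ι ι₂ ι' hcompat W Q_K)) :
    oneCocycleClass (discreteTopRep (κ.layerSubgroup n) (W.geomPrimaryTorsion p)) ψ ∈
      Kobayashi2003.localKummerOverOfEmb W p (κ.layerSubgroup n) ι (Kobayashi2003.signedLocalPointsOfEmb κ ι W ε n) := by
  have hAfix : ∀ P ∈ Kobayashi2003.signedLocalPointsOfEmb κ ι W ε n, ∀ x ∈ localSubgroupOfEmb (κ.layerSubgroup n) ι, x • P = P :=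
    fun P hP x hx ↦ (Kobayashi2003.mem_localLayerPointsOfEmb_iff κ ι W n P).1 (Kobayashi2003.signedLocalPointsOfEmb_le κ ι W ε n hP) x hx
  refine mem_localKummerOverOfEmb_of_kummer_on_index_two W p (κ.layerSubgroup n) ι hp2
    (localSubgroupOfEmb (κ.layerSubgroup n ⊓ galRange (K := k) K) ι) (localSubgroupOfEmb_inf_le _ _ ι) hc
    (mul_self_mem_localSubgroupOfEmb_inf hU hc) (conj_mem_localSubgroupOfEmb_inf hU hc) (mem_or_inv_mul_mem_localSubgroupOfEmb_inf hU hc hcU)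
    (Kobayashi2003.signedLocalPointsOfEmb κ ι W ε n) (Kobayashi2003.signedLocalPointsOfEmb κ ι W ε n)
    (fun P hP ↦ by rw [hAfix P hP c hc]; exact hP) (fun P hP x hx ↦ hAfix P hP x (localSubgroupOfEmb_inf_le _ _ ι hx)) (fun P hP _ ↦ hP)
    ψ ha _ k' ?_ hψ
  rw [nsmul_add_smul_transportPoints]
  exact transportPoints_add_smul_mem_signedLocalPointsOfEmb hp2 κ K hK2 ι ι₂ ι' hcompat hι₂ hfixU hU W ε n hc hcU hQA

end AtP

end Summit.BirchSwinnertonDyer.BirchSwinnertonDyer.Theorems.SmallImageCharSignedSelmer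

end
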